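import Summits.QuantumFields.BalabanUV.Beta.EriceRemainderEnclosureHistoryRenewalBlocks

/-!
# EriceRemainderEnclosureHistoryRenewalExtremalTail — (E34d) the dichotomy by the TAIL of the AF weights: through the row system, a bound
# `W` on the total feedback weight at infrared distance `> n₀` costs only `m·D·W·(2−q)∕(1−q)` on top of (E34c)'s pin-zone bound; hence a
# GEOMETRIC tail `Σ_{l<K−n} w_l ≤ U·τ^n` gives a geometric two-run matching rate up to a linear prefactor (abstract real sequences)

Cell `pub-balaban`, β-function sub-cell, BINDER row D4 «RemainderConst leaves for Bałaban's split» (`HOME/BINDER-OWNERS.md`; owner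
lineage `b2b-balaban-beta-an4`; this file by co-owner #2 lineage `b2b-balaban-beta-d4-p2`, generation 36), β-FLOW TEAM duty (1),
FREEZE (0) honoured (def-free; ABSTRACT real sequences only).  Sequel of (E34c) `EriceRemainderEnclosureHistoryRenewalExtremalPin` (the
pin-SUPPORTED case `W = 0`), companion of (E34a) `EriceRemainderEnclosureHistoryRenewalExtremal` (polynomial tail ⟹ no geometric rate).

HONEST FRAMING.  [folklore] real analysis; nothing of Bałaban's [I] is quoted, typed or asserted here; row D4 class UNCHANGED
(critical-path width 0; instance 0∕1; D4 DISCHARGE NO DATE); NOT B12 Thm 2, NOT BetaPertH, NOT continuum, NOT Clay.  HONEST DEPENDENCY: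
continuum YM on T⁴ ⇐ BetaPertH ∧ nine spine estimates (0/9 proved); BetaPertH ⇐ (D1) ∧ (D4) ∧ CAP+tail; G-an2-4 gates asym, D1 and NE2/3/4.
RELEVANCE (binding): along asymptotically free runs the tail of the AF weights at infrared distance `n` is `≍ n^{−1∕2}` (weights
`≍ (bn)^{−3∕2}`) — POLYNOMIAL, not geometric — so this file is NOT a β-level geometric rate; it states precisely which concentration of the
feedback at the pin WOULD give one through the row system, completing the dichotomy of (E34a)∕(E34c).

THE MECHANISM.  As (E34c) with the support hypothesis replaced by a tail budget `Σ_{l<K−n₀} w_l ≤ W` and an a-priori bound `δ ≤ D` on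
`[0, K]` ((E33b) `bound_of_split` supplies `D = S₀∕(1−q)`): bulk rows now read `δ_l ≤ δ_{l+1} + cθ^l + m·w_l·D` (§1 `bulkTail_step`), so
`δ_j ≤ P + cθ^j∕(1−θ) + m·D·W` for `j + n₀ ≤ K` (`bulkTail_le`); the pin zone absorbs as before with the window reaching back to
`i₀ = ⌊(K−n₀)∕2⌋`: `P ≤ ((3n₀+1)·cθ^{i₀}∕(1−θ) + m·D·W)∕(1−q)` (`pinZoneTail_le`); hence
`δ_j ≤ (3n₀+1)c∕((1−θ)(1−q))·θ^{⌊(K−n₀)∕2⌋} + m·D·W·(2−q)∕(1−q) + cθ^j∕(1−θ)` (§2 `geometric_of_tail`), for EVERY `n₀` with its `W`.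
With a GEOMETRIC tail `Σ_{l<K−n} w_l ≤ U·τ^n` for all `n` choose `n₀ = ⌊j∕2⌋`: `δ_j ≤ (3⌊j∕2⌋+1)·C₁·θ^{⌊(j−⌊j∕2⌋)∕2⌋} + C₂·τ^{⌊j∕2⌋} + cθ^j∕(1−θ)`
K-uniformly (§2 `geometric_of_geometricTail`) — geometric in `j` up to the linear prefactor.

WHAT IS PROVED ([folklore]; 0 `def`, 0 sorry): §1 `bulkTail_step`, `bulkTail_le`, `pinZoneTail_le`; §2 `geometric_of_tail`,
`geometric_of_geometricTail`.
-/

noncomputable section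
open Finset

namespace Summit.QuantumFields.BalabanUV.Beta.EriceRemainderEnclosureHistoryRenewalExtremalTail

open Summit.QuantumFields.BalabanUV.Beta.EriceRemainderEnclosureHistoryRenewalBlocks (backward_sum_from)

/-! ## §1 Bulk rows with a weight budget; the pin zone absorbs -/

/-- A bulk row with an a-priori bound `δ ≤ D` on `[0, l]`: `δ_l ≤ δ_{l+1} + cθ^l + m·w_l·D`. [folklore] -/
theorem bulkTail_step {K : ℕ} {δ w : ℕ → ℝ} {c θ m D : ℝ}
    (hfull : ∀ l, l < K → ∀ B' : ℝ, (∀ i, i ≤ l → δ i ≤ B') → δ l ≤ δ (l + 1) + c * θ ^ l + m * w l * B')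
    (hD : ∀ i, i ≤ K → δ i ≤ D) {l : ℕ} (hl : l < K) : δ l ≤ δ (l + 1) + c * θ ^ l + m * w l * D :=
  hfull l hl D fun i hi => hD i (by omega)

/-- **THE BULK WITH A TAIL BUDGET**: if `Σ_{l<K−n₀} w_l ≤ W`, `δ ≤ D` on `[0, K]` (`D ≥ 0`, `m ≥ 0`, `w ≥ 0`) and `P` bounds `δ` on the pin
zone `[K − n₀, K]`, then `δ_j ≤ P + cθ^j∕(1−θ) + m·D·W` for every `j + n₀ ≤ K`. [folklore] -/
theorem bulkTail_le {K n₀ : ℕ} {δ w : ℕ → ℝ} {c θ m D W P : ℝ} (hc : 0 ≤ c) (hθ0 : 0 ≤ θ) (hθ1 : θ < 1) (hm : 0 ≤ m)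
    (hw : ∀ i, i ≤ K → 0 ≤ w i) (hD0 : 0 ≤ D) (hD : ∀ i, i ≤ K → δ i ≤ D) (hW : ∑ l ∈ range (K - n₀), w l ≤ W)
    (hfull : ∀ l, l < K → ∀ B' : ℝ, (∀ i, i ≤ l → δ i ≤ B') → δ l ≤ δ (l + 1) + c * θ ^ l + m * w l * B')
    (hP : ∀ i, K - n₀ ≤ i → i ≤ K → δ i ≤ P) {j : ℕ} (hj : j + n₀ ≤ K) :
    δ j ≤ P + c * θ ^ j / (1 - θ) + m * D * W := by
  have hstep : ∀ l, j ≤ l → l < K - n₀ → (δ l - P) ≤ (δ (l + 1) - P) + (c * θ ^ l + m * D * w l) := by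
    intro l _ hl
    have := bulkTail_step hfull hD (l := l) (by omega)
    linarith
  have h0 : (fun i => δ i - P) (K - n₀) ≤ 0 := by
    have := hP (K - n₀) le_rfl (Nat.sub_le _ _)
    show δ (K - n₀) - P ≤ 0
    linarith
  have h1 : δ j - P ≤ ∑ l ∈ Ico j (K - n₀), (c * θ ^ l + m * D * w l) :=
    backward_sum_from (δ := fun i => δ i - P) (s := fun l => c * θ ^ l + m * D * w l) (K := K - n₀) (J := j) h0 hstep j le_rfl
      (by omega)
  have h2 : ∑ l ∈ Ico j (K - n₀), c * θ ^ l ≤ c * θ ^ j / (1 - θ) := by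
    rw [← mul_sum, mul_div_assoc]
    exact mul_le_mul_of_nonneg_left (geom_sum_Ico_le_of_lt_one hθ0 hθ1) hc
  have h3 : ∑ l ∈ Ico j (K - n₀), m * D * w l ≤ m * D * W := by
    rw [← mul_sum]
    refine mul_le_mul_of_nonneg_left ?_ (mul_nonneg hm hD0)
    exact (sum_le_sum_of_subset_of_nonneg (fun i hi => mem_range.mpr (mem_Ico.mp hi).2)
      (fun i hi _ => hw i (by have := mem_range.mp hi; omega))).trans hW
  rw [sum_add_distrib] at h1
  linarith

/-- **THE PIN ZONE ABSORBS (tail budget)**: with `i₀ = ⌊(K − n₀)∕2⌋`, `Σ_{l≤K} w_l ≤ U`, `q = m·U < 1`, `Σ_{l<K−n₀} w_l ≤ W`, `δ ≤ D` on `[0, K]`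
and `P` the LARGEST value of `δ` on `[K − n₀, K]`: `P ≤ ((3n₀ + 1)·cθ^{i₀}∕(1−θ) + m·D·W)∕(1−q)`. [folklore] -/
theorem pinZoneTail_le {K n₀ : ℕ} {δ w : ℕ → ℝ} {c θ m U D W : ℝ} (hc : 0 ≤ c) (hθ0 : 0 ≤ θ) (hθ1 : θ < 1) (hm : 0 ≤ m)
    (hw : ∀ i, i ≤ K → 0 ≤ w i) (hU : ∑ l ∈ range (K + 1), w l ≤ U) (hq : m * U < 1)
    (hδ : ∀ i, 0 ≤ δ i) (hK : δ K = 0) (hD0 : 0 ≤ D) (hD : ∀ i, i ≤ K → δ i ≤ D) (hW0 : 0 ≤ W)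
    (hW : ∑ l ∈ range (K - n₀), w l ≤ W)
    (hrec : ∀ l, l < K → ∀ s : ℕ, ∀ B' : ℝ, (∀ i, l - s ≤ i → i ≤ l → δ i ≤ B') →
      δ l ≤ δ (l + 1) + c * θ ^ l + 2 * (c * θ ^ s / (1 - θ)) + m * w l * B')
    (hfull : ∀ l, l < K → ∀ B' : ℝ, (∀ i, i ≤ l → δ i ≤ B') → δ l ≤ δ (l + 1) + c * θ ^ l + m * w l * B')
    {istar : ℕ} (hi1 : K - n₀ ≤ istar) (hi2 : istar ≤ K) (hmax : ∀ i, K - n₀ ≤ i → i ≤ K → δ i ≤ δ istar) :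
    δ istar ≤ ((3 * n₀ + 1) * (c * θ ^ ((K - n₀) / 2) / (1 - θ)) + m * D * W) / (1 - m * U) := by
  set P := δ istar with hPdef
  set i₀ := (K - n₀) / 2 with hi₀
  have h1θ : 0 < 1 - θ := by linarith
  have hU0 : 0 ≤ U := (sum_nonneg fun i hi => hw i (Nat.lt_succ_iff.mp (mem_range.mp hi))).trans hU
  have hP0 : 0 ≤ P := hδ istar
  have hθi : 0 ≤ c * θ ^ i₀ := mul_nonneg hc (pow_nonneg hθ0 _)
  have hmDW : 0 ≤ m * D * W := mul_nonneg (mul_nonneg hm hD0) hW0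
  set Bst := P + c * θ ^ i₀ / (1 - θ) + m * D * W with hBst
  have hBst0 : 0 ≤ Bst := add_nonneg (add_nonneg hP0 (div_nonneg hθi h1θ.le)) hmDW
  have hall : ∀ i, i₀ ≤ i → i ≤ K → δ i ≤ Bst := by
    intro i hi hiK
    by_cases hz : K - n₀ ≤ i
    · have := hmax i hz hiK
      have : 0 ≤ c * θ ^ i₀ / (1 - θ) := div_nonneg hθi h1θ.le
      linarith
    · have hb := bulkTail_le (P := P) hc hθ0 hθ1 hm hw hD0 hD hW hfull hmax (j := i) (by omega)
      have hθle : c * θ ^ i / (1 - θ) ≤ c * θ ^ i₀ / (1 - θ) :=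
        div_le_div_of_nonneg_right (mul_le_mul_of_nonneg_left (pow_le_pow_of_le_one hθ0 hθ1.le hi) hc) h1θ.le
      linarith
  have hrow : ∀ l, istar ≤ l → l < K → δ l ≤ δ (l + 1) + (3 * (c * θ ^ i₀ / (1 - θ)) + m * w l * Bst) := by
    intro l hl hlK
    have hli : i₀ ≤ l := by omega
    have h := hrec l hlK (l - i₀) Bst (fun i hi1 hi2 => hall i (by omega) (by omega))
    have hdel : c * θ ^ (l - i₀) / (1 - θ) ≤ c * θ ^ i₀ / (1 - θ) :=
      div_le_div_of_nonneg_right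
        (mul_le_mul_of_nonneg_left (pow_le_pow_of_le_one hθ0 hθ1.le (by omega)) hc) h1θ.le
    have hsrc : c * θ ^ l ≤ c * θ ^ i₀ / (1 - θ) := by
      have h1 : c * θ ^ l ≤ c * θ ^ i₀ := mul_le_mul_of_nonneg_left (pow_le_pow_of_le_one hθ0 hθ1.le hli) hc
      have h2 : c * θ ^ i₀ ≤ c * θ ^ i₀ / (1 - θ) := by
        rw [le_div_iff₀ h1θ]; nlinarith
      linarith
    linarith
  have hsum := backward_sum_from (s := fun l => 3 * (c * θ ^ i₀ / (1 - θ)) + m * w l * Bst) (le_of_eq hK) hrow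
    istar le_rfl hi2
  have hsplit : ∑ l ∈ Ico istar K, (3 * (c * θ ^ i₀ / (1 - θ)) + m * w l * Bst)
      = ((K - istar : ℕ) : ℝ) * (3 * (c * θ ^ i₀ / (1 - θ))) + m * Bst * ∑ l ∈ Ico istar K, w l := by
    rw [sum_add_distrib, sum_const, Nat.card_Ico, nsmul_eq_mul, mul_sum]
    exact congrArg _ (sum_congr rfl fun l _ => by ring)
  have hcnt : ((K - istar : ℕ) : ℝ) ≤ n₀ := by exact_mod_cast (by omega : K - istar ≤ n₀)
  have hwsum : ∑ l ∈ Ico istar K, w l ≤ U :=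
    (sum_le_sum_of_subset_of_nonneg (fun i hi => mem_range.mpr (by have := (mem_Ico.mp hi).2; omega))
      (fun i hi _ => hw i (Nat.lt_succ_iff.mp (mem_range.mp hi)))).trans hU
  have h3 : 0 ≤ 3 * (c * θ ^ i₀ / (1 - θ)) := by positivity
  have hPle : P ≤ n₀ * (3 * (c * θ ^ i₀ / (1 - θ))) + m * U * Bst := by
    have h4 : ((K - istar : ℕ) : ℝ) * (3 * (c * θ ^ i₀ / (1 - θ))) ≤ n₀ * (3 * (c * θ ^ i₀ / (1 - θ))) :=
      mul_le_mul_of_nonneg_right hcnt h3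
    have h5 : m * Bst * ∑ l ∈ Ico istar K, w l ≤ m * Bst * U := mul_le_mul_of_nonneg_left hwsum (mul_nonneg hm hBst0)
    calc P ≤ _ := hsum
      _ = _ := hsplit
      _ ≤ n₀ * (3 * (c * θ ^ i₀ / (1 - θ))) + m * U * Bst := by linarith
  have h1q : 0 < 1 - m * U := by linarith
  have hq0 : 0 ≤ m * U := mul_nonneg hm hU0
  rw [le_div_iff₀ h1q]
  have e1 : m * U * Bst = m * U * P + m * U * (c * θ ^ i₀ / (1 - θ)) + m * U * (m * D * W) := by rw [hBst]; ring
  rw [e1] at hPle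
  have h6 : m * U * (c * θ ^ i₀ / (1 - θ)) ≤ 1 * (c * θ ^ i₀ / (1 - θ)) :=
    mul_le_mul_of_nonneg_right hq.le (div_nonneg hθi h1θ.le)
  have h7 : m * U * (m * D * W) ≤ 1 * (m * D * W) := mul_le_mul_of_nonneg_right hq.le hmDW
  have e4 : P * (1 - m * U) = P - m * U * P := by ring
  rw [e4]
  linarith

/-! ## §2 The tail dichotomy -/

/-- **A TAIL BUDGET GIVES THE PIN-ZONE RATE PLUS `m·D·W·(2−q)∕(1−q)`.**  Row system as in (E34a) `rowSystem_not_geometric` (`c ≥ 0`,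
`0 ≤ θ < 1`, `m ≥ 0`, `w ≥ 0`, `Σ_{l≤K} w_l ≤ U`, `q = m·U < 1`, `δ ≥ 0`, `δ_K = 0`, split rows for every window, full-window rows), an a-priori
bound `δ ≤ D` on `[0, K]` and a tail budget `Σ_{l<K−n₀} w_l ≤ W`.  THEN for every `j ≤ K`:
`δ_j ≤ (3n₀+1)·c∕((1−θ)(1−q))·θ^{⌊(K−n₀)∕2⌋} + m·D·W·(2−q)∕(1−q) + cθ^j∕(1−θ)`.  (`W = 0`: (E34c) `geometric_of_pinSupported`.) [folklore] -/
theorem geometric_of_tail {K n₀ : ℕ} {δ w : ℕ → ℝ} {c θ m U D W : ℝ} (hc : 0 ≤ c) (hθ0 : 0 ≤ θ) (hθ1 : θ < 1)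
    (hm : 0 ≤ m) (hw : ∀ i, i ≤ K → 0 ≤ w i) (hU : ∑ l ∈ range (K + 1), w l ≤ U) (hq : m * U < 1)
    (hδ : ∀ i, 0 ≤ δ i) (hK : δ K = 0) (hD0 : 0 ≤ D) (hD : ∀ i, i ≤ K → δ i ≤ D) (hW0 : 0 ≤ W)
    (hW : ∑ l ∈ range (K - n₀), w l ≤ W)
    (hrec : ∀ l, l < K → ∀ s : ℕ, ∀ B' : ℝ, (∀ i, l - s ≤ i → i ≤ l → δ i ≤ B') →
      δ l ≤ δ (l + 1) + c * θ ^ l + 2 * (c * θ ^ s / (1 - θ)) + m * w l * B')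
    (hfull : ∀ l, l < K → ∀ B' : ℝ, (∀ i, i ≤ l → δ i ≤ B') → δ l ≤ δ (l + 1) + c * θ ^ l + m * w l * B') :
    ∀ j, j ≤ K → δ j ≤ (3 * n₀ + 1) * c / ((1 - θ) * (1 - m * U)) * θ ^ ((K - n₀) / 2)
      + m * D * W * (2 - m * U) / (1 - m * U) + c * θ ^ j / (1 - θ) := by
  have hne : (Icc (K - n₀) K).Nonempty := ⟨K, mem_Icc.mpr ⟨Nat.sub_le _ _, le_rfl⟩⟩
  obtain ⟨istar, histar, hmax⟩ := exists_max_image (Icc (K - n₀) K) δ hne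
  rw [mem_Icc] at histar
  have hmax' : ∀ i, K - n₀ ≤ i → i ≤ K → δ i ≤ δ istar := fun i h1 h2 => hmax i (mem_Icc.mpr ⟨h1, h2⟩)
  have hP := pinZoneTail_le hc hθ0 hθ1 hm hw hU hq hδ hK hD0 hD hW0 hW hrec hfull histar.1 histar.2 hmax'
  have h1θ : 0 < 1 - θ := by linarith
  have hU0 : 0 ≤ U := (sum_nonneg fun i hi => hw i (Nat.lt_succ_iff.mp (mem_range.mp hi))).trans hU
  have h1q : 0 < 1 - m * U := by linarith
  have hmDW : 0 ≤ m * D * W := mul_nonneg (mul_nonneg hm hD0) hW0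
  have e : ((3 * n₀ + 1) * (c * θ ^ ((K - n₀) / 2) / (1 - θ)) + m * D * W) / (1 - m * U) + m * D * W
      = (3 * n₀ + 1) * c / ((1 - θ) * (1 - m * U)) * θ ^ ((K - n₀) / 2) + m * D * W * (2 - m * U) / (1 - m * U) := by
    field_simp
    ring
  intro j hj
  by_cases hz : j + n₀ ≤ K
  · have hb := bulkTail_le (P := δ istar) hc hθ0 hθ1 hm hw hD0 hD hW hfull hmax' hz
    linarith
  · have h1 := hmax' j (by omega) hj
    have h2 : 0 ≤ c * θ ^ j / (1 - θ) := div_nonneg (mul_nonneg hc (pow_nonneg hθ0 _)) h1θ.le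
    linarith

/-- **GEOMETRIC TAIL ⟹ GEOMETRIC RATE (up to a linear prefactor), K-UNIFORMLY.**  If moreover the tail of the weights is geometric in the
infrared distance, `Σ_{l<K−n} w_l ≤ U·τ^n` for every `n` (`0 ≤ τ`), then for every `j ≤ K` (choosing `n₀ = ⌊j∕2⌋`):
`δ_j ≤ (3⌊j∕2⌋+1)·c∕((1−θ)(1−q))·θ^{⌊(j−⌊j∕2⌋)∕2⌋} + m·D·U·(2−q)∕(1−q)·τ^{⌊j∕2⌋} + cθ^j∕(1−θ)`.  Asymptotically free runs have the
POLYNOMIAL tail `≍ n^{−1∕2}` instead (RELEVANCE clause). [folklore] -/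
theorem geometric_of_geometricTail {K : ℕ} {δ w : ℕ → ℝ} {c θ m U D τ : ℝ} (hc : 0 ≤ c) (hθ0 : 0 ≤ θ) (hθ1 : θ < 1)
    (hm : 0 ≤ m) (hw : ∀ i, i ≤ K → 0 ≤ w i) (hU : ∑ l ∈ range (K + 1), w l ≤ U) (hq : m * U < 1)
    (hδ : ∀ i, 0 ≤ δ i) (hK : δ K = 0) (hD0 : 0 ≤ D) (hD : ∀ i, i ≤ K → δ i ≤ D) (hτ : 0 ≤ τ)
    (htail : ∀ n, ∑ l ∈ range (K - n), w l ≤ U * τ ^ n)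
    (hrec : ∀ l, l < K → ∀ s : ℕ, ∀ B' : ℝ, (∀ i, l - s ≤ i → i ≤ l → δ i ≤ B') →
      δ l ≤ δ (l + 1) + c * θ ^ l + 2 * (c * θ ^ s / (1 - θ)) + m * w l * B')
    (hfull : ∀ l, l < K → ∀ B' : ℝ, (∀ i, i ≤ l → δ i ≤ B') → δ l ≤ δ (l + 1) + c * θ ^ l + m * w l * B') :
    ∀ j, j ≤ K → δ j ≤ (3 * (j / 2 : ℕ) + 1) * c / ((1 - θ) * (1 - m * U)) * θ ^ ((j - j / 2) / 2)
      + m * D * (U * τ ^ (j / 2)) * (2 - m * U) / (1 - m * U) + c * θ ^ j / (1 - θ) := by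
  intro j hj
  have hU0 : 0 ≤ U := (sum_nonneg fun i hi => hw i (Nat.lt_succ_iff.mp (mem_range.mp hi))).trans hU
  have hW0 : 0 ≤ U * τ ^ (j / 2) := mul_nonneg hU0 (pow_nonneg hτ _)
  have h := geometric_of_tail (n₀ := j / 2) hc hθ0 hθ1 hm hw hU hq hδ hK hD0 hD hW0 (htail (j / 2)) hrec hfull j hj
  have h1θ : 0 < 1 - θ := by linarith
  have h1q : 0 < 1 - m * U := by linarith
  have hA : 0 ≤ (3 * ((j / 2 : ℕ) : ℝ) + 1) * c / ((1 - θ) * (1 - m * U)) := by positivity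
  have hp : θ ^ ((K - j / 2) / 2) ≤ θ ^ ((j - j / 2) / 2) :=
    pow_le_pow_of_le_one hθ0 hθ1.le (Nat.div_le_div_right (by omega))
  have := mul_le_mul_of_nonneg_left hp hA
  linarith

end Summit.QuantumFields.BalabanUV.Beta.EriceRemainderEnclosureHistoryRenewalExtremalTail

end
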